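import Literature.LinearAlgebra.Matrix.NumericalRadiusKatoRefinements
import Mathlib.Analysis.Convex.SpecificFunctions.Pow
import HarnessLib

/-!
# Young-type bounds for powers of the numerical radius of products `A^α X B^α`, `A^α X B^{1−α}`, `B^*A`
# (Sattari–Moslehian–Yamazaki 2015, § 3 and Proposition 2.9): `wʳ(A^αXB^α) ≤ ‖X‖ʳ‖(1/p)A^{pr} + (1/q)B^{qr}‖^α`,
# `w(|T|^{1/2}U|T|^{1/2}) ≤ ‖T‖`, `wʳ(A^αXB^{1−α}) ≤ ‖X‖ʳ‖αAʳ + (1−α)Bʳ‖`, `wʳ(B^*A) ≤ ‖(1/p)|A|^{pr} + (1/q)|B|^{qr}‖`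

Hodge foundations lane (`lit-hodgefound`, prover p24 gen 64 #8; matrix-analysis series), a sequel of
`NumericalRadiusBuzanoBounds.lean` (#4: § 2 of the same paper) and `NumericalRadiusKatoRefinements.lean` (#7: the
Hölder–McCarthy steps `⟨S^α x,x⟩^s ≤ ⟨S^{αs}x,x⟩`, `Re⟨Mx,x⟩ ≤ ‖M‖`), on top of the tree's `LoewnerHeinzInequality`
(real powers `A ^ r` of `A ⪰ 0`), `HeinzKatoFurutaInequality` (`‖A^α x‖² = ⟨A^{2α}x, x⟩`) and `HolderMcCarthyInequality`.
THEOREMS ONLY: no definition, no named fact, net debt 0.  Complex square matrices, spectral norm (scoped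
`Matrix.Norms.L2Operator`), Euclidean vector norms `‖toLp 2 v‖`.

DEF-FREE CONVENTIONS (as in the predecessors): unit vector `star x ⬝ᵥ x = 1`, `⟨Tx, x⟩ = star x ⬝ᵥ (T *ᵥ x)`, a bound
`wʳ(S) ≤ M` is vendored pointwise: `|⟨Sx, x⟩|ʳ ≤ M` for every unit `x` («Now by taking the supremum over x ∈ ℋ with
‖x‖ = 1 …»); `|A|^s = (A^*A)^{s/2} = (Aᴴ * A) ^ (s/2)`, `|T| = CFC.sqrt (Tᴴ * T)`; real exponents are `CFC.rpow` powers of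
positive semidefinite matrices.

## Source, VERBATIM

M. Sattari, M. S. Moslehian, T. Yamazaki, *Some generalized numerical radius inequalities for Hilbert space operators*,
Linear Algebra Appl. 470 (2015) 216–227 [SattariMoslehianYamazaki2015] (held text `paper:arxiv-1409.0321`, pp. 4–6).
«**Lemma 2.1.** Let a, b ≥ 0, 0 ≤ α ≤ 1 and p, q > 1 such that 1/p + 1/q = 1. Then (a) `a^α b^{1−α} ≤ αa + (1−α)b`,
(b) `ab ≤ a^p/p + b^q/q`.»  «**Lemma 2.2 (McCarty inequality).** Let A ∈ 𝔹(ℋ), A ≥ 0 and let x ∈ ℋ be any unit vector.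
Then (a) `⟨Ax, x⟩ʳ ≤ ⟨Aʳx, x⟩` for r ≥ 1, (b) `⟨Aʳx, x⟩ ≤ ⟨Ax, x⟩ʳ` for 0 < r ≤ 1.»
«**Proposition 2.9.** Let A, B ∈ B(ℋ). Then `wʳ(B^*A) ≤ ‖(1/p)|A|^{pr} + (1/q)|B|^{qr}‖` holds for all r ≥ 0 and p, q > 1
with 1/p + 1/q = 1 and pr, qr ≥ 2.»
«**Theorem 3.1.** Suppose A, B, X ∈ 𝔹(ℋ) such that A, B are positive. Then `wʳ(A^αXB^α) ≤ ‖X‖ʳ‖(1/p)A^{pr}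
+ (1/q)B^{qr}‖^α` for all 0 ≤ α ≤ 1, r ≥ 0 and p, q > 1 with 1/p + 1/q = 1 and pr, qr ≥ 2.  *Proof.* For any unit vector
x ∈ ℋ and by the Cauchy–Schwarz inequality we have `|⟨A^αXB^αx, x⟩|ʳ = |⟨XB^αx, A^αx⟩|ʳ ≤ ‖XB^αx‖ʳ‖A^αx‖ʳ
≤ ‖X‖ʳ⟨A^{2α}x,x⟩^{r/2}⟨B^{2α}x,x⟩^{r/2} ≤ ‖X‖ʳ((1/p)⟨A^{2α}x,x⟩^{pr/2} + (1/q)⟨B^{2α}x,x⟩^{qr/2})` (by Lemma 2.1 (b))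
`≤ ‖X‖ʳ((1/p)⟨A^{pr}x,x⟩^α + (1/q)⟨B^{qr}x,x⟩^α)` (by Lemma 2.2) `≤ ‖X‖ʳ((1/p)⟨A^{pr}x,x⟩ + (1/q)⟨B^{qr}x,x⟩)^α`
(by the concavity of t^α) `= ‖X‖ʳ⟨((1/p)A^{pr} + (1/q)B^{qr})x, x⟩^α`.  Now by taking the supremum over x ∈ ℋ with
‖x‖ = 1 in the above inequality we infer that Theorem 3.1.»
«**Corollary 3.2.** Let `T̃ = |T|^{1/2}U|T|^{1/2}` be the Aluthge transformation of T such that U is partial isometry.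
Then `w(T̃) ≤ ‖T‖`.  *Proof.* If we take r = 1, α = ½, p = q = 2, A = B = |T| and X = U in Theorem 3.1, then
`w(T̃) ≤ ‖½|T|² + ½|T|²‖^{1/2} = ‖|T|²‖^{1/2} = ‖T‖`.»
«**Theorem 3.3.** Suppose A, B, X ∈ 𝔹(ℋ) such that A, B are positive. Then `wʳ(A^αXB^{1−α}) ≤ ‖X‖ʳ‖αAʳ
+ (1−α)Bʳ‖` for all r ≥ 2 and 0 ≤ α ≤ 1.  *Proof.* Let x ∈ ℋ be a unit vector. Then `|⟨A^αXB^{1−α}x, x⟩|ʳ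
= |⟨XB^{1−α}x, A^αx⟩|ʳ ≤ ‖X‖ʳ‖B^{1−α}x‖ʳ‖A^αx‖ʳ = ‖X‖ʳ⟨B^{2(1−α)}x,x⟩^{r/2}⟨A^{2α}x,x⟩^{r/2}
≤ ‖X‖ʳ⟨Aʳx,x⟩^α⟨Bʳx,x⟩^{1−α}` (by Lemma 2.2) `≤ ‖X‖ʳ⟨(αAʳ + (1−α)Bʳ)x, x⟩` (by Lemma 2.1 (a)).  Taking the supremum
over x ∈ ℋ with ‖x‖ = 1 in the above inequality we deduce the desired inequality.»

## What is proved (all theorems)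

§ 1 the vector steps: `norm_toLp_rpow_mulVec_sq` (`‖A^αx‖² = ⟨A^{2α}x,x⟩`), `norm_dotProduct_mulVec_le`
(`|u^*Xv| ≤ ‖X‖‖u‖‖v‖`), `quadForm_rpow_mul_mul_rpow` (`⟨A^αXB^βx, x⟩ = (A^αx)^*X(B^βx)`), the McCarthy step
`norm_toLp_rpow_mulVec_rpow_le` (`‖A^αx‖^r ≤ ⟨A^s x,x⟩^{αr/s}` for `2α ≤ s`); § 2 **Theorem 3.1**
`sattariMoslehianYamazaki_thm_3_1_pointwise` / `_thm_3_1`; § 3 **Corollary 3.2** `sattariMoslehianYamazaki_cor_3_2` (for every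
contraction `U`, in particular the polar partial isometry); § 4 **Theorem 3.3** `sattariMoslehianYamazaki_thm_3_3_pointwise` /
`_thm_3_3`; § 5 **Proposition 2.9** `sattariMoslehianYamazaki_prop_2_9_pointwise` / `_prop_2_9`.
-/

noncomputable section

open Matrix WithLp
open scoped ComplexOrder MatrixOrder ComplexConjugate InnerProductSpace Matrix.Norms.L2Operator

namespace Literature.LinearAlgebra.Matrix.NumericalRadiusYoungTypeBounds

open Literature.LinearAlgebra.Matrix.LoewnerHeinzInequality (posSemidef_rpow conjTranspose_rpow rpow_rpow_of_nonneg
  rpow_one rpow_two rpow_zero)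
open Literature.LinearAlgebra.Matrix.HeinzKatoFurutaInequality (star_rpow_mulVec_dotProduct sqrt_rpow_of_nonneg)
open Literature.LinearAlgebra.Matrix.HolderMcCarthyInequality (holderMcCarthy_one_le holderMcCarthy_le_one)
open Literature.LinearAlgebra.Matrix.NumericalRadiusKatoRefinements (re_quadForm_le_l2_opNorm re_quadForm_rpow_nonneg
  re_quadForm_rpow_rpow_le)

variable {n : Type*} [Fintype n] [DecidableEq n]

/-! ## § 1. The vector steps -/

section Steps

omit [DecidableEq n] in
/-- `‖v‖² = Re(v^*v)`. [folklore] -/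
private theorem norm_toLp_sq_eq_re (v : n → ℂ) :
    ‖(toLp 2 v : EuclideanSpace ℂ n)‖ ^ 2 = RCLike.re (star v ⬝ᵥ v) := by
  rw [← inner_self_eq_norm_sq (𝕜 := ℂ), EuclideanSpace.inner_toLp_toLp, dotProduct_comm]

/-- **`‖A^αx‖² = ⟨A^{2α}x, x⟩`** for `A ⪰ 0`, `α ≥ 0`. [cite: SattariMoslehianYamazaki2015, Theorem 3.1 (proof:
«`‖XB^αx‖ʳ‖A^αx‖ʳ ≤ ‖X‖ʳ⟨A^{2α}x,x⟩^{r/2}⟨B^{2α}x,x⟩^{r/2}`»)] -/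
theorem norm_toLp_rpow_mulVec_sq {A : Matrix n n ℂ} (hA : A.PosSemidef) {α : ℝ} (hα : 0 ≤ α) (x : n → ℂ) :
    ‖(toLp 2 (A ^ α *ᵥ x) : EuclideanSpace ℂ n)‖ ^ 2 = RCLike.re (star x ⬝ᵥ (A ^ (2 * α) *ᵥ x)) := by
  rw [norm_toLp_sq_eq_re, star_rpow_mulVec_dotProduct hA hα]

omit [DecidableEq n] in
/-- **Cauchy–Schwarz with the operator norm: `|u^*Xv| = |⟨Xv, u⟩| ≤ ‖X‖‖u‖‖v‖`.** [cite: SattariMoslehianYamazaki2015,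
Theorem 3.1 (proof: «by the Cauchy–Schwarz inequality … `≤ ‖XB^αx‖ʳ‖A^αx‖ʳ ≤ ‖X‖ʳ …`»)] -/
theorem norm_dotProduct_mulVec_le [DecidableEq n] (X : Matrix n n ℂ) (u v : n → ℂ) :
    ‖star u ⬝ᵥ (X *ᵥ v)‖ ≤ ‖X‖ * (‖(toLp 2 u : EuclideanSpace ℂ n)‖ * ‖(toLp 2 v : EuclideanSpace ℂ n)‖) := by
  have h1 : star u ⬝ᵥ (X *ᵥ v) = ⟪(toLp 2 u : EuclideanSpace ℂ n), toLp 2 (X *ᵥ v)⟫_ℂ := by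
    rw [EuclideanSpace.inner_toLp_toLp, dotProduct_comm]
  have h2 : ‖(toLp 2 (X *ᵥ v) : EuclideanSpace ℂ n)‖ ≤ ‖X‖ * ‖(toLp 2 v : EuclideanSpace ℂ n)‖ :=
    Matrix.l2_opNorm_mulVec X (toLp 2 v)
  rw [h1]
  calc ‖⟪(toLp 2 u : EuclideanSpace ℂ n), toLp 2 (X *ᵥ v)⟫_ℂ‖
      ≤ ‖(toLp 2 u : EuclideanSpace ℂ n)‖ * ‖(toLp 2 (X *ᵥ v) : EuclideanSpace ℂ n)‖ := norm_inner_le_norm _ _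
    _ ≤ ‖(toLp 2 u : EuclideanSpace ℂ n)‖ * (‖X‖ * ‖(toLp 2 v : EuclideanSpace ℂ n)‖) := by gcongr
    _ = ‖X‖ * (‖(toLp 2 u : EuclideanSpace ℂ n)‖ * ‖(toLp 2 v : EuclideanSpace ℂ n)‖) := by ring

/-- **`⟨A^αXB^βx, x⟩ = ⟨XB^βx, A^αx⟩ = (A^αx)^*X(B^βx)`** (`A^α` is Hermitian). [cite: SattariMoslehianYamazaki2015,
Theorem 3.1 (proof: «`|⟨A^αXB^αx, x⟩|ʳ = |⟨XB^αx, A^αx⟩|ʳ`»)] -/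
theorem quadForm_rpow_mul_mul_rpow (A X B : Matrix n n ℂ) (α β : ℝ) (x : n → ℂ) :
    star x ⬝ᵥ ((A ^ α * X * B ^ β) *ᵥ x) = star (A ^ α *ᵥ x) ⬝ᵥ (X *ᵥ (B ^ β *ᵥ x)) := by
  rw [star_mulVec, ← dotProduct_mulVec, conjTranspose_rpow, mulVec_mulVec, mulVec_mulVec]

/-- **The McCarthy step: `‖A^αx‖ʳ = ⟨A^{2α}x, x⟩^{r/2} ≤ ⟨A^s x, x⟩^{αr/s}`** for `A ⪰ 0`, a unit `x`, `α, r ≥ 0` and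
`0 < s` with `2α ≤ s` (`A^{2α} = (A^s)^{2α/s}` and Lemma 2.2 (b) with the exponent `2α/s ≤ 1`).
[cite: SattariMoslehianYamazaki2015, Theorem 3.1 (proof: «`⟨A^{2α}x,x⟩^{pr/2} ≤ ⟨A^{pr}x,x⟩^α` (by Lemma 2.2)»)] -/
theorem norm_toLp_rpow_mulVec_rpow_le {A : Matrix n n ℂ} (hA : A.PosSemidef) {x : n → ℂ} (hx : star x ⬝ᵥ x = 1)
    {α r s : ℝ} (hα : 0 ≤ α) (hr : 0 ≤ r) (hs : 0 < s) (hαs : 2 * α ≤ s) :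
    ‖(toLp 2 (A ^ α *ᵥ x) : EuclideanSpace ℂ n)‖ ^ r ≤ RCLike.re (star x ⬝ᵥ (A ^ s *ᵥ x)) ^ (α * r / s) := by
  -- `⟨A^{2α}x,x⟩ = ⟨(A^s)^{2α/s}x,x⟩ ≤ ⟨A^s x,x⟩^{2α/s}`
  have ht0 : 0 ≤ 2 * α / s := by positivity
  have ht1 : 2 * α / s ≤ 1 := (div_le_one hs).mpr hαs
  have hMc := holderMcCarthy_le_one (posSemidef_rpow A s) hx ht0 ht1
  rw [rpow_rpow_of_nonneg hA hs.le ht0, mul_div_cancel₀ _ hs.ne'] at hMc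
  have hsq := norm_toLp_rpow_mulVec_sq hA hα x
  have hN := norm_nonneg (toLp 2 (A ^ α *ᵥ x) : EuclideanSpace ℂ n)
  have hU := re_quadForm_rpow_nonneg A s x
  generalize ‖(toLp 2 (A ^ α *ᵥ x) : EuclideanSpace ℂ n)‖ = N at hsq hN ⊢
  generalize RCLike.re (star x ⬝ᵥ (A ^ s *ᵥ x)) = U at hMc hU ⊢
  rw [← hsq] at hMc
  -- `N^r = (N²)^{r/2} ≤ (U^{2α/s})^{r/2} = U^{αr/s}`
  calc N ^ r = (N ^ 2) ^ (r / 2) := by rw [← Real.rpow_two, ← Real.rpow_mul hN, mul_div_cancel₀ _ two_ne_zero]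
    _ ≤ (U ^ (2 * α / s)) ^ (r / 2) := Real.rpow_le_rpow (sq_nonneg N) hMc (by positivity)
    _ = U ^ (α * r / s) := by rw [← Real.rpow_mul hU]; congr 1; ring

omit [DecidableEq n] in
/-- `⟨(cM)x, x⟩ = c⟨Mx, x⟩` for a real scalar `c` (real parts). [folklore] -/
private theorem re_quadForm_real_smul (c : ℝ) (M : Matrix n n ℂ) (x : n → ℂ) :
    RCLike.re (star x ⬝ᵥ (((c : ℂ) • M) *ᵥ x)) = c * RCLike.re (star x ⬝ᵥ (M *ᵥ x)) := by
  rw [smul_mulVec, dotProduct_smul, smul_eq_mul, RCLike.re_to_complex, RCLike.re_to_complex,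
    Complex.re_ofReal_mul]

omit [DecidableEq n] in
/-- `⟨(M + N)x, x⟩ = ⟨Mx, x⟩ + ⟨Nx, x⟩` (real parts). [folklore] -/
private theorem re_quadForm_add (M N : Matrix n n ℂ) (x : n → ℂ) :
    RCLike.re (star x ⬝ᵥ ((M + N) *ᵥ x)) = RCLike.re (star x ⬝ᵥ (M *ᵥ x)) + RCLike.re (star x ⬝ᵥ (N *ᵥ x)) := by
  rw [add_mulVec, dotProduct_add, map_add]

/-- **The Young step (Lemma 2.1 (b)):** if `0 ≤ t ≤ K·N_A·N_B` with `K, N_A, N_B ≥ 0`, `r ≥ 0`, `1/p + 1/q = 1`, `p > 1`,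
and `N_A^{rp} ≤ M_A`, `N_B^{rq} ≤ M_B`, then `tʳ ≤ Kʳ(M_A/p + M_B/q)` (`N_AʳN_Bʳ ≤ N_A^{rp}/p + N_B^{rq}/q`).
[cite: SattariMoslehianYamazaki2015, Lemma 2.1 (b) and Theorem 3.1 (proof, the step «by Lemma 2.1 (b)»)] -/
theorem rpow_le_of_young {t K NA NB MA MB r p q : ℝ} (ht0 : 0 ≤ t) (hK : 0 ≤ K) (hNA : 0 ≤ NA) (hNB : 0 ≤ NB)
    (hr : 0 ≤ r) (hp : 1 < p) (hpq : p⁻¹ + q⁻¹ = 1) (ht : t ≤ K * (NA * NB)) (hA : NA ^ (r * p) ≤ MA)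
    (hB : NB ^ (r * q) ≤ MB) : t ^ r ≤ K ^ r * (MA / p + MB / q) := by
  have hpq' : p.HolderConjugate q := Real.holderConjugate_iff.mpr ⟨hp, hpq⟩
  have hq : 1 < q := hpq'.symm.lt
  have hy := Real.young_inequality_of_nonneg (Real.rpow_nonneg hNA r) (Real.rpow_nonneg hNB r) hpq'
  rw [← Real.rpow_mul hNA, ← Real.rpow_mul hNB] at hy
  calc t ^ r ≤ (K * (NA * NB)) ^ r := Real.rpow_le_rpow ht0 ht hr
    _ = K ^ r * (NA ^ r * NB ^ r) := by rw [Real.mul_rpow hK (mul_nonneg hNA hNB), Real.mul_rpow hNA hNB]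
    _ ≤ K ^ r * (NA ^ (r * p) / p + NB ^ (r * q) / q) := by gcongr
    _ ≤ K ^ r * (MA / p + MB / q) := by gcongr

end Steps

/-! ## § 2. Theorem 3.1: `wʳ(A^αXB^α) ≤ ‖X‖ʳ‖(1/p)A^{pr} + (1/q)B^{qr}‖^α` -/

section Thm31

variable {A B : Matrix n n ℂ} (X : Matrix n n ℂ) {x : n → ℂ}

/-- **Theorem 3.1, pointwise with the quadratic form:** for `A, B ⪰ 0`, any `X`, `0 ≤ α ≤ 1`, `r ≥ 0`, `p, q > 1` with
`1/p + 1/q = 1`, `pr, qr ≥ 2` and a unit `x`, `|⟨A^αXB^αx, x⟩|ʳ ≤ ‖X‖ʳ⟨((1/p)A^{pr} + (1/q)B^{qr})x, x⟩^α`.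
[cite: SattariMoslehianYamazaki2015, Theorem 3.1 (proof, the displayed chain for a unit vector `x`)] -/
theorem sattariMoslehianYamazaki_thm_3_1_pointwise (hA : A.PosSemidef) (hB : B.PosSemidef) {α : ℝ} (hα0 : 0 ≤ α)
    (hα1 : α ≤ 1) {r p q : ℝ} (hr : 0 ≤ r) (hp : 1 < p) (hq : 1 < q) (hpq : p⁻¹ + q⁻¹ = 1) (hpr : 2 ≤ p * r)
    (hqr : 2 ≤ q * r) (hx : star x ⬝ᵥ x = 1) :
    ‖star x ⬝ᵥ ((A ^ α * X * B ^ α) *ᵥ x)‖ ^ r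
      ≤ ‖X‖ ^ r * RCLike.re (star x ⬝ᵥ
          ((((p⁻¹ : ℝ) : ℂ) • A ^ (p * r) + ((q⁻¹ : ℝ) : ℂ) • B ^ (q * r)) *ᵥ x)) ^ α := by
  have hp0 : 0 < p := by linarith
  have hq0 : 0 < q := by linarith
  have hr0 : 0 < r := pos_of_mul_pos_right (by linarith : 0 < p * r) hp0.le
  -- Cauchy–Schwarz: `t ≤ ‖X‖‖A^αx‖‖B^αx‖`
  have ht : ‖star x ⬝ᵥ ((A ^ α * X * B ^ α) *ᵥ x)‖ ≤ ‖X‖ * (‖(toLp 2 (A ^ α *ᵥ x) : EuclideanSpace ℂ n)‖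
      * ‖(toLp 2 (B ^ α *ᵥ x) : EuclideanSpace ℂ n)‖) := by
    rw [quadForm_rpow_mul_mul_rpow]
    exact norm_dotProduct_mulVec_le X _ _
  -- McCarthy: `‖A^αx‖^{rp} ≤ ⟨A^{pr}x,x⟩^α`, `‖B^αx‖^{rq} ≤ ⟨B^{qr}x,x⟩^α`
  have hMA := norm_toLp_rpow_mulVec_rpow_le hA hx hα0 (r := r * p) (s := p * r) (by positivity) (by positivity)
    (by nlinarith)
  have hMB := norm_toLp_rpow_mulVec_rpow_le hB hx hα0 (r := r * q) (s := q * r) (by positivity) (by positivity)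
    (by nlinarith)
  rw [show α * (r * p) / (p * r) = α by
    rw [mul_comm r p, mul_div_cancel_right₀ _ (by positivity : p * r ≠ 0)]] at hMA
  rw [show α * (r * q) / (q * r) = α by
    rw [mul_comm r q, mul_div_cancel_right₀ _ (by positivity : q * r ≠ 0)]] at hMB
  have hy := rpow_le_of_young (norm_nonneg _) (norm_nonneg X) (norm_nonneg _) (norm_nonneg _) hr hp hpq ht hMA hMB
  -- concavity of `t ↦ t^α`
  have hU := re_quadForm_rpow_nonneg A (p * r) x
  have hV := re_quadForm_rpow_nonneg B (q * r) x
  have hconc := (Real.concaveOn_rpow hα0 hα1).2 (Set.mem_Ici.mpr hU) (Set.mem_Ici.mpr hV)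
    (by positivity : (0 : ℝ) ≤ p⁻¹) (by positivity : (0 : ℝ) ≤ q⁻¹) hpq
  simp only [smul_eq_mul] at hconc
  rw [re_quadForm_add, re_quadForm_real_smul, re_quadForm_real_smul]
  calc ‖star x ⬝ᵥ ((A ^ α * X * B ^ α) *ᵥ x)‖ ^ r
      ≤ ‖X‖ ^ r * (RCLike.re (star x ⬝ᵥ (A ^ (p * r) *ᵥ x)) ^ α / p
          + RCLike.re (star x ⬝ᵥ (B ^ (q * r) *ᵥ x)) ^ α / q) := hy
    _ = ‖X‖ ^ r * (p⁻¹ * RCLike.re (star x ⬝ᵥ (A ^ (p * r) *ᵥ x)) ^ α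
          + q⁻¹ * RCLike.re (star x ⬝ᵥ (B ^ (q * r) *ᵥ x)) ^ α) := by
        rw [div_eq_inv_mul, div_eq_inv_mul]
    _ ≤ ‖X‖ ^ r * (p⁻¹ * RCLike.re (star x ⬝ᵥ (A ^ (p * r) *ᵥ x))
          + q⁻¹ * RCLike.re (star x ⬝ᵥ (B ^ (q * r) *ᵥ x))) ^ α := by gcongr

/-- **Theorem 3.1: `wʳ(A^αXB^α) ≤ ‖X‖ʳ‖(1/p)A^{pr} + (1/q)B^{qr}‖^α`** (`A, B ⪰ 0`, `0 ≤ α ≤ 1`, `r ≥ 0`, `p, q > 1`,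
`1/p + 1/q = 1`, `pr, qr ≥ 2`), pointwise for every unit `x`. [cite: SattariMoslehianYamazaki2015, Theorem 3.1] -/
theorem sattariMoslehianYamazaki_thm_3_1 (hA : A.PosSemidef) (hB : B.PosSemidef) {α : ℝ} (hα0 : 0 ≤ α)
    (hα1 : α ≤ 1) {r p q : ℝ} (hr : 0 ≤ r) (hp : 1 < p) (hq : 1 < q) (hpq : p⁻¹ + q⁻¹ = 1) (hpr : 2 ≤ p * r)
    (hqr : 2 ≤ q * r) (hx : star x ⬝ᵥ x = 1) :
    ‖star x ⬝ᵥ ((A ^ α * X * B ^ α) *ᵥ x)‖ ^ r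
      ≤ ‖X‖ ^ r * ‖((p⁻¹ : ℝ) : ℂ) • A ^ (p * r) + ((q⁻¹ : ℝ) : ℂ) • B ^ (q * r)‖ ^ α := by
  have h := sattariMoslehianYamazaki_thm_3_1_pointwise X hA hB hα0 hα1 hr hp hq hpq hpr hqr hx
  have hp0 : 0 < p := by linarith
  have hq0 : 0 < q := by linarith
  have hN := re_quadForm_le_l2_opNorm (((p⁻¹ : ℝ) : ℂ) • A ^ (p * r) + ((q⁻¹ : ℝ) : ℂ) • B ^ (q * r)) hx
  have h0 : 0 ≤ RCLike.re (star x ⬝ᵥ ((((p⁻¹ : ℝ) : ℂ) • A ^ (p * r) + ((q⁻¹ : ℝ) : ℂ) • B ^ (q * r)) *ᵥ x)) := by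
    rw [re_quadForm_add, re_quadForm_real_smul, re_quadForm_real_smul]
    exact add_nonneg (mul_nonneg (by positivity) (re_quadForm_rpow_nonneg A _ x))
      (mul_nonneg (by positivity) (re_quadForm_rpow_nonneg B _ x))
  exact h.trans (mul_le_mul_of_nonneg_left (Real.rpow_le_rpow h0 hN hα0) (Real.rpow_nonneg (norm_nonneg X) r))

end Thm31

/-! ## § 3. Corollary 3.2: `w(|T|^{1/2}U|T|^{1/2}) ≤ ‖T‖` -/

section Cor32

variable (T : Matrix n n ℂ) {x : n → ℂ}

/-- **Corollary 3.2: `w(T̃) ≤ ‖T‖` for the Aluthge transform `T̃ = |T|^{1/2}U|T|^{1/2}`**, here for EVERY contraction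
`U` (`‖U‖ ≤ 1`; the partial isometry of the polar decomposition is one), pointwise: `|⟨|T|^{1/2}U|T|^{1/2}x, x⟩| ≤ ‖T‖`
for every unit `x` (Theorem 3.1 with `r = 1`, `α = ½`, `p = q = 2`, `A = B = |T|`, `X = U`:
`≤ ‖U‖·‖½|T|² + ½|T|²‖^{1/2} = ‖U‖‖T‖`). [cite: SattariMoslehianYamazaki2015, Corollary 3.2] -/
theorem sattariMoslehianYamazaki_cor_3_2 {U : Matrix n n ℂ} (hU : ‖U‖ ≤ 1) (hx : star x ⬝ᵥ x = 1) :
    ‖star x ⬝ᵥ ((CFC.sqrt (Tᴴ * T) ^ (1 / 2 : ℝ) * U * CFC.sqrt (Tᴴ * T) ^ (1 / 2 : ℝ)) *ᵥ x)‖ ≤ ‖T‖ := by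
  have hP : (Tᴴ * T).PosSemidef := posSemidef_conjTranspose_mul_self T
  have hS : (CFC.sqrt (Tᴴ * T)).PosSemidef := by
    rw [CFC.sqrt_eq_rpow]; exact posSemidef_rpow _ _
  have h := sattariMoslehianYamazaki_thm_3_1 U hS hS (α := 1 / 2) (by norm_num) (by norm_num) (r := 1) (p := 2)
    (q := 2) zero_le_one one_lt_two one_lt_two (by norm_num) (by norm_num) (by norm_num) hx
  have h2 : CFC.sqrt (Tᴴ * T) ^ ((2 : ℝ) * 1) = Tᴴ * T := by
    rw [mul_one, sqrt_rpow_of_nonneg hP zero_le_two, div_self two_ne_zero, rpow_one hP]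
  rw [Real.rpow_one, Real.rpow_one, h2, ← add_smul, ← Complex.ofReal_add, show (2⁻¹ + 2⁻¹ : ℝ) = 1 by norm_num,
    Complex.ofReal_one, one_smul, Matrix.l2_opNorm_conjTranspose_mul_self, ← sq, ← Real.sqrt_eq_rpow,
    Real.sqrt_sq (norm_nonneg T)] at h
  calc ‖star x ⬝ᵥ ((CFC.sqrt (Tᴴ * T) ^ (1 / 2 : ℝ) * U * CFC.sqrt (Tᴴ * T) ^ (1 / 2 : ℝ)) *ᵥ x)‖
      ≤ ‖U‖ * ‖T‖ := h
    _ ≤ 1 * ‖T‖ := by gcongr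
    _ = ‖T‖ := one_mul _

end Cor32

/-! ## § 4. Theorem 3.3: `wʳ(A^αXB^{1−α}) ≤ ‖X‖ʳ‖αAʳ + (1−α)Bʳ‖` -/

section Thm33

variable {A B : Matrix n n ℂ} (X : Matrix n n ℂ) {x : n → ℂ}

/-- **Theorem 3.3, pointwise with the quadratic form:** for `A, B ⪰ 0`, any `X`, `0 ≤ α ≤ 1`, `r ≥ 2` and a unit `x`,
`|⟨A^αXB^{1−α}x, x⟩|ʳ ≤ ‖X‖ʳ⟨(αAʳ + (1−α)Bʳ)x, x⟩` (Cauchy–Schwarz, Lemma 2.2 (b) twice, Lemma 2.1 (a)).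
[cite: SattariMoslehianYamazaki2015, Theorem 3.3 (proof, the displayed chain for a unit vector `x`)] -/
theorem sattariMoslehianYamazaki_thm_3_3_pointwise (hA : A.PosSemidef) (hB : B.PosSemidef) {α : ℝ} (hα0 : 0 ≤ α)
    (hα1 : α ≤ 1) {r : ℝ} (hr : 2 ≤ r) (hx : star x ⬝ᵥ x = 1) :
    ‖star x ⬝ᵥ ((A ^ α * X * B ^ (1 - α)) *ᵥ x)‖ ^ r
      ≤ ‖X‖ ^ r * RCLike.re (star x ⬝ᵥ ((((α : ℝ) : ℂ) • A ^ r + (((1 - α : ℝ)) : ℂ) • B ^ r) *ᵥ x)) := by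
  have hr0 : 0 < r := by linarith
  have ht : ‖star x ⬝ᵥ ((A ^ α * X * B ^ (1 - α)) *ᵥ x)‖ ≤ ‖X‖ * (‖(toLp 2 (A ^ α *ᵥ x) : EuclideanSpace ℂ n)‖
      * ‖(toLp 2 (B ^ (1 - α) *ᵥ x) : EuclideanSpace ℂ n)‖) := by
    rw [quadForm_rpow_mul_mul_rpow]
    exact norm_dotProduct_mulVec_le X _ _
  -- McCarthy: `‖A^αx‖ʳ ≤ ⟨Aʳx,x⟩^α`, `‖B^{1−α}x‖ʳ ≤ ⟨Bʳx,x⟩^{1−α}`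
  have hMA := norm_toLp_rpow_mulVec_rpow_le hA hx hα0 (r := r) (s := r) hr0.le hr0 (by nlinarith)
  have hMB := norm_toLp_rpow_mulVec_rpow_le hB hx (α := 1 - α) (by linarith) (r := r) (s := r) hr0.le hr0
    (by nlinarith)
  rw [mul_div_assoc, div_self hr0.ne', mul_one] at hMA hMB
  have hU := re_quadForm_rpow_nonneg A r x
  have hV := re_quadForm_rpow_nonneg B r x
  -- Lemma 2.1 (a): `U^α V^{1−α} ≤ αU + (1−α)V`
  have hamgm := Real.geom_mean_le_arith_mean2_weighted hα0 (by linarith : 0 ≤ 1 - α) hU hV (by ring)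
  have hNA := norm_nonneg (toLp 2 (A ^ α *ᵥ x) : EuclideanSpace ℂ n)
  have hNB := norm_nonneg (toLp 2 (B ^ (1 - α) *ᵥ x) : EuclideanSpace ℂ n)
  rw [re_quadForm_add, re_quadForm_real_smul, re_quadForm_real_smul]
  generalize ‖(toLp 2 (A ^ α *ᵥ x) : EuclideanSpace ℂ n)‖ = NA at ht hMA hNA
  generalize ‖(toLp 2 (B ^ (1 - α) *ᵥ x) : EuclideanSpace ℂ n)‖ = NB at ht hMB hNB
  generalize RCLike.re (star x ⬝ᵥ (A ^ r *ᵥ x)) = U at hMA hU hamgm ⊢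
  generalize RCLike.re (star x ⬝ᵥ (B ^ r *ᵥ x)) = V at hMB hV hamgm ⊢
  have ht0 := norm_nonneg (star x ⬝ᵥ ((A ^ α * X * B ^ (1 - α)) *ᵥ x))
  generalize ‖star x ⬝ᵥ ((A ^ α * X * B ^ (1 - α)) *ᵥ x)‖ = t at ht ht0 ⊢
  calc t ^ r ≤ (‖X‖ * (NA * NB)) ^ r := Real.rpow_le_rpow ht0 ht hr0.le
    _ = ‖X‖ ^ r * (NA ^ r * NB ^ r) := by
        rw [Real.mul_rpow (norm_nonneg X) (mul_nonneg hNA hNB), Real.mul_rpow hNA hNB]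
    _ ≤ ‖X‖ ^ r * (U ^ α * V ^ (1 - α)) := by
        gcongr ‖X‖ ^ r * ?_
        exact mul_le_mul hMA hMB (Real.rpow_nonneg hNB r) (Real.rpow_nonneg hU α)
    _ ≤ ‖X‖ ^ r * (α * U + (1 - α) * V) := by gcongr

/-- **Theorem 3.3: `wʳ(A^αXB^{1−α}) ≤ ‖X‖ʳ‖αAʳ + (1−α)Bʳ‖`** (`A, B ⪰ 0`, `0 ≤ α ≤ 1`, `r ≥ 2`), pointwise for every
unit `x`. [cite: SattariMoslehianYamazaki2015, Theorem 3.3] -/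
theorem sattariMoslehianYamazaki_thm_3_3 (hA : A.PosSemidef) (hB : B.PosSemidef) {α : ℝ} (hα0 : 0 ≤ α)
    (hα1 : α ≤ 1) {r : ℝ} (hr : 2 ≤ r) (hx : star x ⬝ᵥ x = 1) :
    ‖star x ⬝ᵥ ((A ^ α * X * B ^ (1 - α)) *ᵥ x)‖ ^ r
      ≤ ‖X‖ ^ r * ‖((α : ℝ) : ℂ) • A ^ r + (((1 - α : ℝ)) : ℂ) • B ^ r‖ := by
  have h := sattariMoslehianYamazaki_thm_3_3_pointwise X hA hB hα0 hα1 hr hx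
  have hN := re_quadForm_le_l2_opNorm (((α : ℝ) : ℂ) • A ^ r + (((1 - α : ℝ)) : ℂ) • B ^ r) hx
  exact h.trans (mul_le_mul_of_nonneg_left hN (Real.rpow_nonneg (norm_nonneg X) r))

end Thm33

/-! ## § 5. Proposition 2.9: `wʳ(B^*A) ≤ ‖(1/p)|A|^{pr} + (1/q)|B|^{qr}‖` -/

section Prop29

variable (A B : Matrix n n ℂ) {x : n → ℂ}

omit [DecidableEq n] in
/-- `⟨B^*Ax, x⟩ = (Bx)^*(Ax)` and `|⟨B^*Ax, x⟩| ≤ ‖Ax‖‖Bx‖`. [cite: SattariMoslehianYamazaki2015, Proposition 2.9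
(the Cauchy–Schwarz step of Theorem 3.1 with `X = I`)] -/
theorem norm_quadForm_conjTranspose_mul_le (x : n → ℂ) :
    ‖star x ⬝ᵥ ((Bᴴ * A) *ᵥ x)‖
      ≤ ‖(toLp 2 (A *ᵥ x) : EuclideanSpace ℂ n)‖ * ‖(toLp 2 (B *ᵥ x) : EuclideanSpace ℂ n)‖ := by
  have h1 : star x ⬝ᵥ ((Bᴴ * A) *ᵥ x) = ⟪(toLp 2 (B *ᵥ x) : EuclideanSpace ℂ n), toLp 2 (A *ᵥ x)⟫_ℂ := by
    rw [EuclideanSpace.inner_toLp_toLp, star_mulVec, dotProduct_comm (A *ᵥ x), ← dotProduct_mulVec, mulVec_mulVec]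
  rw [h1, mul_comm]
  exact norm_inner_le_norm _ _

omit [DecidableEq n] in
/-- `‖Ax‖² = ⟨A^*Ax, x⟩ = ⟨|A|²x, x⟩`. [cite: SattariMoslehianYamazaki2015, Proposition 2.9 (step `‖Ax‖ = ⟨|A|²x,x⟩^{1/2}`)] -/
theorem norm_toLp_mulVec_sq_eq_re (x : n → ℂ) :
    ‖(toLp 2 (A *ᵥ x) : EuclideanSpace ℂ n)‖ ^ 2 = RCLike.re (star x ⬝ᵥ ((Aᴴ * A) *ᵥ x)) := by
  rw [norm_toLp_sq_eq_re, star_mulVec, ← dotProduct_mulVec, mulVec_mulVec]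

/-- The McCarthy step for `|A|`: `‖Ax‖^s = ⟨A^*Ax, x⟩^{s/2} ≤ ⟨(A^*A)^{s/2}x, x⟩` for a unit `x` and `s ≥ 2`
(Lemma 2.2 (a) with the exponent `s/2 ≥ 1`). [cite: SattariMoslehianYamazaki2015, Proposition 2.9 (step «by Lemma 2.2 (a)»
as in Proposition 2.5)] -/
theorem norm_toLp_mulVec_rpow_le (hx : star x ⬝ᵥ x = 1) {s : ℝ} (hs : 2 ≤ s) :
    ‖(toLp 2 (A *ᵥ x) : EuclideanSpace ℂ n)‖ ^ s ≤ RCLike.re (star x ⬝ᵥ ((Aᴴ * A) ^ (s / 2) *ᵥ x)) := by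
  have hP : (Aᴴ * A).PosSemidef := posSemidef_conjTranspose_mul_self A
  have hMc := holderMcCarthy_one_le hP hx (r := s / 2) (by linarith)
  have hsq := norm_toLp_mulVec_sq_eq_re A x
  have hN := norm_nonneg (toLp 2 (A *ᵥ x) : EuclideanSpace ℂ n)
  generalize ‖(toLp 2 (A *ᵥ x) : EuclideanSpace ℂ n)‖ = N at hsq hN ⊢
  rw [← hsq] at hMc
  calc N ^ s = (N ^ 2) ^ (s / 2) := by rw [← Real.rpow_two, ← Real.rpow_mul hN, mul_div_cancel₀ _ two_ne_zero]
    _ ≤ RCLike.re (star x ⬝ᵥ ((Aᴴ * A) ^ (s / 2) *ᵥ x)) := hMc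

/-- **Proposition 2.9, pointwise with the quadratic form:** for any `A, B`, `r ≥ 0`, `p, q > 1` with `1/p + 1/q = 1`,
`pr, qr ≥ 2` and a unit `x`, `|⟨B^*Ax, x⟩|ʳ ≤ ⟨((1/p)|A|^{pr} + (1/q)|B|^{qr})x, x⟩`, `|A|^{pr} = (A^*A)^{pr/2}`.
[cite: SattariMoslehianYamazaki2015, Proposition 2.9 (proof as in Proposition 2.5 / Theorem 3.1 with `X = I`)] -/
theorem sattariMoslehianYamazaki_prop_2_9_pointwise {r p q : ℝ} (hr : 0 ≤ r) (hp : 1 < p) (hq : 1 < q)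
    (hpq : p⁻¹ + q⁻¹ = 1) (hpr : 2 ≤ p * r) (hqr : 2 ≤ q * r) (hx : star x ⬝ᵥ x = 1) :
    ‖star x ⬝ᵥ ((Bᴴ * A) *ᵥ x)‖ ^ r
      ≤ RCLike.re (star x ⬝ᵥ ((((p⁻¹ : ℝ) : ℂ) • (Aᴴ * A) ^ (p * r / 2)
          + ((q⁻¹ : ℝ) : ℂ) • (Bᴴ * B) ^ (q * r / 2)) *ᵥ x)) := by
  have hp0 : 0 < p := by linarith
  have hq0 : 0 < q := by linarith
  have ht : ‖star x ⬝ᵥ ((Bᴴ * A) *ᵥ x)‖ ≤ 1 * (‖(toLp 2 (A *ᵥ x) : EuclideanSpace ℂ n)‖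
      * ‖(toLp 2 (B *ᵥ x) : EuclideanSpace ℂ n)‖) := by
    rw [one_mul]; exact norm_quadForm_conjTranspose_mul_le A B x
  have hMA := norm_toLp_mulVec_rpow_le A hx (s := r * p) (by nlinarith)
  have hMB := norm_toLp_mulVec_rpow_le B hx (s := r * q) (by nlinarith)
  have hy := rpow_le_of_young (norm_nonneg _) zero_le_one (norm_nonneg _) (norm_nonneg _) hr hp hpq ht hMA hMB
  rw [Real.one_rpow, one_mul, mul_comm r p, mul_comm r q] at hy
  rw [re_quadForm_add, re_quadForm_real_smul, re_quadForm_real_smul, ← div_eq_inv_mul, ← div_eq_inv_mul]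
  exact hy

/-- **Proposition 2.9: `wʳ(B^*A) ≤ ‖(1/p)|A|^{pr} + (1/q)|B|^{qr}‖`** (`r ≥ 0`, `p, q > 1`, `1/p + 1/q = 1`, `pr, qr ≥ 2`),
pointwise for every unit `x`. [cite: SattariMoslehianYamazaki2015, Proposition 2.9] -/
theorem sattariMoslehianYamazaki_prop_2_9 {r p q : ℝ} (hr : 0 ≤ r) (hp : 1 < p) (hq : 1 < q)
    (hpq : p⁻¹ + q⁻¹ = 1) (hpr : 2 ≤ p * r) (hqr : 2 ≤ q * r) (hx : star x ⬝ᵥ x = 1) :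
    ‖star x ⬝ᵥ ((Bᴴ * A) *ᵥ x)‖ ^ r
      ≤ ‖((p⁻¹ : ℝ) : ℂ) • (Aᴴ * A) ^ (p * r / 2) + ((q⁻¹ : ℝ) : ℂ) • (Bᴴ * B) ^ (q * r / 2)‖ :=
  (sattariMoslehianYamazaki_prop_2_9_pointwise A B hr hp hq hpq hpr hqr hx).trans (re_quadForm_le_l2_opNorm _ hx)

end Prop29

end Literature.LinearAlgebra.Matrix.NumericalRadiusYoungTypeBounds
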